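import Summits.QuantumFields.YangMills.Theorems.BalabanUVNodesN15KingModelGriffithsFiniteEta
import Summits.QuantumFields.YangMills.Theorems.BalabanUVNodesN15KingModelFreePropagatorComparison

/-!
# BalabanUVNodes ∕ N15 — THE KING-MODEL RUNG (PART Ϻ-m): CORRELATIONS DECREASE WITH THE MASS — at every finite `η` (resolvent identity + inverse positivity) and in the
# continuum (proper time): `m₁² ≤ m₂² ⇒ S₂[m₂] ≤ S₂[m₁]` entrywise for `(N²(−Δ)+m²)⁻¹`, `S₂^{(K)}`, `(Δ^{(K)})⁻¹`, every `n`-point function, `S₂^{ℝ}` and `C_m`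
# (Track A, DAG node N15 = NE2; FAN-OUT v1.1 §N15 s3 «KING-MODEL RUNG»; uses parts Ϻ-b∕c∕e∕k; count-neutral)

HONEST FRAMING.  Count-neutral (cell `pub-ymgap`, seat `pub-ymgap-dag-n15-e` g35; `--supports stmt-QuantumFields-27366 --as helper` = K3⁸).  King's `A = 0`, `g = 0` model
([King1986] C. King, Commun. Math. Phys. **102** (1986) 649–677).  With part Ϻ-k's inverse positivity `B_m⁻¹ ≥ 0` (`B_m = c(−Δ)+m²`), the resolvent identity
`B_{m₁}⁻¹ − B_{m₂}⁻¹ = (m₂² − m₁²)·B_{m₁}⁻¹B_{m₂}⁻¹` shows that the fine propagator, King's block two-point function `S₂^{(K)} = N^{d+1}QB⁻¹Qᵀ`, NE2's unit kernel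
`(Δ^{(K)})⁻¹ = a_K⁻¹·1 + S₂^{(K)}` and (hafnians being monotone in non-negative entries) EVERY `n`-point function of King's finite-`η` block-field laws are DECREASING functions of
the mass `m²` — at every `K`, every volume; in the continuum, part Ϻ-b's proper-time form `S₂^{ℝ}(z) = (2π)^{−(d+1)}∫e^{−tm²}Π_μI_t(z_μ)dt` (mass only in `e^{−tm²}`) gives the same for
`S₂^{ℝ}` and for part Ϻ-c's `C_m(R)`.  (Griffiths II ∕ Lebowitz-type monotonicity in a quadratic coupling, free-field instance.)  NOT Bałaban's objects; NOT a node discharge;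
nothing continuum-Yang–Mills ∕ `ℝ⁴` ∕ OS ∕ Clay.  0 `sorry`, 0 def; standard axioms.

WHAT THIS FILE PROVES (kernel).  §1 `lapF_sub_lapF` (`B_{m₂} − B_{m₁} = (m₂²−m₁²)·1`), ★ `lapF_inv_sub_inv` (resolvent identity), ★★ **`lapF_inv_anti_mass`**.  §2 ★★ **`kingS2_anti_mass`**, ★★ `blockCov_anti_mass`,
`hafnian_mono_of_nonneg`, ★★ **`nPoint_fineBlockLaw_anti_mass`**, ★★ `nPoint_blockFieldLaw_anti_mass`.  §3 ★★ **`kingS2Inf_anti_mass`**, ★ `freePropRadial_anti_mass`.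

HONEST SCOPE.  King's free model; monotonicity in `m²` only (the dependence on `a` is the additive noise `a_K⁻¹·1`, on the volume not treated).  N15 untouched; counts unmoved.
Locators (use): [King1986] (2.13)–(2.14) p.653, Thm 2.1 (2.22)–(2.23) p.654, (4.4)–(4.5) p.670.
-/

noncomputable section

open scoped BigOperators Topology
open Filter MeasureTheory Finset Matrix Set

namespace Summit.QuantumFields.YangMills.BalabanUVNodes.N15KingModelRung.ProperTime

open Literature.MathematicalPhysics.QuantumFieldTheory.Balaban1983to89.B5Prop11Plancherel (Tor fine)
open Literature.MathematicalPhysics.QuantumFieldTheory.King1986.Torus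
open Literature.MathematicalPhysics.QuantumFieldTheory.King1986 (aK aK_pos)
open Literature.Combinatorics.Enumerative (hafnian)
open Literature.Combinatorics.Enumerative.HafnianGeneratingFunction (subMat)
open Summit.QuantumFields.YangMills.BalabanUVNodes.N15KingModelRung.OptimalDecay
open FreeField

variable {d : ℕ}

/-! ## §1 The resolvent identity and monotonicity of the fine propagator in the mass -/

section Fine

variable {n : ℕ} (K : Fin n → ℕ) [hK : ∀ μ, NeZero (K μ)]

omit hK in
/-- `B_{m₂} − B_{m₁} = (m₂² − m₁²)·1` (the mass enters `c(−Δ)+m²` only on the diagonal). [cite: King1986, (4.4) p.670] -/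
theorem lapF_sub_lapF (c m1 m2 : ℝ) : lapF K c m2 - lapF K c m1 = (m2 - m1) • (1 : Matrix (Tor K) (Tor K) ℝ) := by
  ext z z'
  simp only [lapF, Matrix.sub_apply, Matrix.smul_apply, Matrix.one_apply, smul_eq_mul]
  by_cases h : z = z'
  · subst h; simp
  · rw [if_neg (Ne.symm h), if_neg h]; ring

/-- ★ **Resolvent identity**: `B_{m₁}⁻¹ − B_{m₂}⁻¹ = (m₂²−m₁²)·B_{m₁}⁻¹B_{m₂}⁻¹` (`c ≥ 0`, `m₁², m₂² > 0`). [folklore] -/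
theorem lapF_inv_sub_inv {c m1 m2 : ℝ} (hc : 0 ≤ c) (h1 : 0 < m1) (h2 : 0 < m2) :
    (lapF K c m1)⁻¹ - (lapF K c m2)⁻¹ = (m2 - m1) • ((lapF K c m1)⁻¹ * (lapF K c m2)⁻¹) := by
  have hd1 : IsUnit (lapF K c m1).det := (Matrix.isUnit_iff_isUnit_det _).mp (isUnit_lapF K hc h1)
  have hd2 : IsUnit (lapF K c m2).det := (Matrix.isUnit_iff_isUnit_det _).mp (isUnit_lapF K hc h2)
  have key : (lapF K c m1)⁻¹ * (lapF K c m2 - lapF K c m1) * (lapF K c m2)⁻¹ = (lapF K c m1)⁻¹ - (lapF K c m2)⁻¹ := by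
    rw [Matrix.mul_sub, Matrix.sub_mul, Matrix.mul_assoc, Matrix.mul_nonsing_inv _ hd2, Matrix.mul_one, Matrix.nonsing_inv_mul _ hd1, Matrix.one_mul]
  rw [← key, lapF_sub_lapF, Matrix.mul_smul, Matrix.mul_one, Matrix.smul_mul]

/-- ★★ **THE FINE PROPAGATOR DECREASES WITH THE MASS**: `0 < m₁² ≤ m₂² ⇒ (c(−Δ)+m₂²)⁻¹(z,z′) ≤ (c(−Δ)+m₁²)⁻¹(z,z′)` for all sites (`c ≥ 0`). [cite: King1986, (4.4) p.670, (2.13) p.653] -/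
theorem lapF_inv_anti_mass {c m1 m2 : ℝ} (hc : 0 ≤ c) (h1 : 0 < m1) (h12 : m1 ≤ m2) (z z' : Tor K) : (lapF K c m2)⁻¹ z z' ≤ (lapF K c m1)⁻¹ z z' := by
  have h2 : 0 < m2 := lt_of_lt_of_le h1 h12
  rw [← sub_nonneg]
  have h := congrFun (congrFun (lapF_inv_sub_inv K hc h1 h2) z) z'
  rw [Matrix.sub_apply] at h
  rw [h, Matrix.smul_apply, smul_eq_mul, Matrix.mul_apply]
  exact mul_nonneg (by linarith) (Finset.sum_nonneg fun w _ => mul_nonneg (lapF_inv_nonneg K hc h1 z w) (lapF_inv_nonneg K hc h2 w z'))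

end Fine

/-! ## §2 King's finite-`η` kernels and `n`-point functions decrease with the mass -/

section Kernels

variable (L : ℕ) (M : Fin (d + 1) → ℕ) [hM : ∀ ν, NeZero (M ν)]

omit hM in
/-- ★★ **`S₂^{(K)}` DECREASES WITH THE MASS**: `0 < m₁² ≤ m₂² ⇒ S₂^{(K)}[m₂²](b,b′) ≤ S₂^{(K)}[m₁²](b,b′)` (every `N`, volume, `b, b′`). [cite: King1986, (2.13)–(2.14) p.653] -/
theorem kingS2_anti_mass [∀ ν, NeZero (M ν)] (N : ℕ) [NeZero N] {m1 m2 : ℝ} (h1 : 0 < m1) (h12 : m1 ≤ m2) (b b' : Tor M) : kingS2 N M m2 b b' ≤ kingS2 N M m1 b b' := by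
  unfold kingS2
  refine mul_le_mul_of_nonneg_left ?_ (by positivity)
  rw [Matrix.mul_apply, Matrix.mul_apply]
  refine Finset.sum_le_sum fun w _ => mul_le_mul_of_nonneg_right ?_ (by rw [Matrix.transpose_apply]; exact Qmat_nonneg N M b' w)
  rw [Matrix.mul_apply, Matrix.mul_apply]
  exact Finset.sum_le_sum fun z _ => mul_le_mul_of_nonneg_left (lapF_inv_anti_mass (fine N M) (by positivity) h1 h12 z w) (Qmat_nonneg N M b z)

/-- ★★ **`(Δ^{(K)})⁻¹` DECREASES WITH THE MASS** (`L ≥ 2`, `a > 0`, `K ≥ 1`; the noise `a_K⁻¹·1` is mass-free). [cite: King1986, (2.14) p.653, (4.5) p.670] -/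
theorem blockCov_anti_mass (hL : 2 ≤ L) {a m1 m2 : ℝ} (ha : 0 < a) (h1 : 0 < m1) (h12 : m1 ≤ m2) {K : ℕ} (hK : 1 ≤ K) (b b' : Tor M) :
    haveI : NeZero L := ⟨by omega⟩
    blockCov L (L ^ K) M a m2 K b b' ≤ blockCov L (L ^ K) M a m1 K b b' := by
  haveI : NeZero L := ⟨by omega⟩
  rw [blockCov_eq_kingS2_add_noise L M hL ha (lt_of_lt_of_le h1 h12) hK, blockCov_eq_kingS2_add_noise L M hL ha h1 hK]
  exact add_le_add_left (kingS2_anti_mass M (L ^ K) h1 h12 b b') _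

end Kernels

section NPoint

variable {V : Type*} [Fintype V] [DecidableEq V] [LinearOrder V]

/-- Hafnians are MONOTONE in non-negative entries: `0 ≤ A ≤ B` entrywise ⇒ `Haf A ≤ Haf B`. [folklore] -/
theorem hafnian_mono_of_nonneg {A B : Matrix V V ℝ} (hA : ∀ u v, 0 ≤ A u v) (hAB : ∀ u v, A u v ≤ B u v) : hafnian A ≤ hafnian B :=
  Finset.sum_le_sum fun _ _ => Finset.prod_le_prod (fun _ _ => hA _ _) fun _ _ => hAB _ _

variable (L : ℕ) (M : Fin (d + 1) → ℕ) [hM : ∀ ν, NeZero (M ν)]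
variable {W : Type*} [DecidableEq W] [LinearOrder W]

/-- ★★ **EVERY `n`-POINT FUNCTION OF THE FINE BLOCK AVERAGES DECREASES WITH THE MASS** (`0 < m₁² ≤ m₂²`; every `N`, volume, sites, `S`).
[cite: King1986, (2.6) p.652, (2.13) p.653, Thm 2.1 (2.23) p.654] -/
theorem nPoint_fineBlockLaw_anti_mass (N : ℕ) [NeZero N] {m1 m2 : ℝ} (h1 : 0 < m1) (h12 : m1 ≤ m2) (p : W → Tor M) (S : Finset W) :
    ∫ φ : Tor M → ℝ, (∏ i ∈ S, φ (p i)) * gaussDensity (fineBlockPrec M N m2) φ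
      ≤ ∫ φ : Tor M → ℝ, (∏ i ∈ S, φ (p i)) * gaussDensity (fineBlockPrec M N m1) φ := by
  rw [integral_prod_eval_fineBlockLaw_eq_hafnian M N (lt_of_lt_of_le h1 h12) p S, integral_prod_eval_fineBlockLaw_eq_hafnian M N h1 p S]
  exact hafnian_mono_of_nonneg (fun u v => kingS2_nonneg M N (lt_of_lt_of_le h1 h12) _ _) fun u v => kingS2_anti_mass M N h1 h12 _ _

/-- ★★ **EVERY `n`-POINT FUNCTION OF KING's RG MEASURES `dμ^{(K)}` DECREASES WITH THE MASS** (`L ≥ 2`, `a > 0`, `K ≥ 1`, `0 < m₁² ≤ m₂²`).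
[cite: King1986, (2.10)–(2.14) pp.652–653, (4.5) p.670] -/
theorem nPoint_blockFieldLaw_anti_mass (hL : 2 ≤ L) {a m1 m2 : ℝ} (ha : 0 < a) (h1 : 0 < m1) (h12 : m1 ≤ m2) {K : ℕ} (hK : 1 ≤ K) (p : W → Tor M) (S : Finset W) :
    haveI : NeZero L := ⟨by omega⟩
    ∫ ψ : Tor M → ℝ, (∏ i ∈ S, ψ (p i)) * gaussDensity (effLaplacian (L ^ K) M (aK a L K) (((L ^ K : ℕ) : ℝ) ^ 2) m2) ψ
      ≤ ∫ ψ : Tor M → ℝ, (∏ i ∈ S, ψ (p i)) * gaussDensity (effLaplacian (L ^ K) M (aK a L K) (((L ^ K : ℕ) : ℝ) ^ 2) m1) ψ := by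
  haveI : NeZero L := ⟨by omega⟩
  rw [integral_prod_eval_blockFieldLaw_eq_hafnian L M hL ha (lt_of_lt_of_le h1 h12) hK p S, integral_prod_eval_blockFieldLaw_eq_hafnian L M hL ha h1 hK p S]
  exact hafnian_mono_of_nonneg (fun u v => blockCov_nonneg L M hL ha (lt_of_lt_of_le h1 h12) hK _ _) fun u v => blockCov_anti_mass L M hL ha h1 h12 hK _ _

end NPoint

/-! ## §3 The continuum: `S₂^{ℝ}` and `C_m` decrease with the mass -/

/-- ★★ **`S₂^{ℝ}` DECREASES WITH THE MASS**: `0 < m₁² ≤ m₂² ⇒ S₂^{ℝ}[m₂²](z) ≤ S₂^{ℝ}[m₁²](z)` for every `z` (proper time: the mass sits in `e^{−tm²}` only).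
[cite: King1986, Thm 2.1 (2.22) p.654, (4.5) p.670] -/
theorem kingS2Inf_anti_mass {m1 m2 : ℝ} (h1 : 0 < m1) (h12 : m1 ≤ m2) (z : Fin (d + 1) → ℤ) : kingS2Inf m2 z ≤ kingS2Inf m1 z := by
  have h2 : 0 < m2 := lt_of_lt_of_le h1 h12
  rw [kingS2Inf_eq_integral_properTime h2 z, kingS2Inf_eq_integral_properTime h1 z]
  refine mul_le_mul_of_nonneg_left ?_ (by positivity)
  refine setIntegral_mono_on (integrableOn_properTime h2 z) (integrableOn_properTime h1 z) measurableSet_Ioi fun t ht => ?_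
  have ht : 0 < t := ht
  refine mul_le_mul_of_nonneg_right (Real.exp_le_exp.mpr (by nlinarith)) (Finset.prod_nonneg fun μ _ => lineHeat_nonneg ht _)

/-- ★ **`C_m(R)` DECREASES WITH THE MASS** (`R > 0`, `0 < m₁² ≤ m₂²`). [folklore] -/
theorem freePropRadial_anti_mass {m1 m2 R : ℝ} (h1 : 0 < m1) (h12 : m1 ≤ m2) (hR : 0 < R) : freePropRadial d m2 R ≤ freePropRadial d m1 R := by
  have h2 : 0 < m2 := lt_of_lt_of_le h1 h12
  unfold freePropRadial
  refine setIntegral_mono_on (integrableOn_exp_mul_heatRadial h2 hR) (integrableOn_exp_mul_heatRadial h1 hR) measurableSet_Ioi fun t ht => ?_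
  have ht : 0 < t := ht
  exact mul_le_mul_of_nonneg_right (Real.exp_le_exp.mpr (by nlinarith)) (heatRadial_nonneg _ _)

end Summit.QuantumFields.YangMills.BalabanUVNodes.N15KingModelRung.ProperTime
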